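import Literature.Analysis.FluidPDE.ESSLocalHolderTopCylinder
import HarnessLib

/-!
# Escauriaza–Seregin–Šverák's local theorem at the top of a backward cylinder of any size and
  viscosity, II: `L^∞_t L³_x` gives a representative CONTINUOUS UP TO THE TOP

Analysis/FluidPDE proofs file (no definitions, no named facts). Companion of
`ESSLocalHolderTopCylinder.lean` (`ess_bounded_near_top_of_L3`), which transported only the BOUND
of the Hölder representative furnished by the tree's `ess_local_holder_holds` (ESS 2003, Thm. 1.4: on
the unit cylinder the solution is a.e. equal to a function Hölder continuous on the CLOSURE of
`Q_{1/2}(0,0)`, top `t = 0` included). This file transports the representative itself: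

* `ess_continuousOn_near_top_of_L3` — let `ν > 0` and let `(Q_ρ(T, x₀), 0, u, p, G)` lie in
  Lemarié-Rieusset's §14.3 class with zero force and `u ∈ L^∞(T - ρ², T; L³(B_ρ(x₀)))`. Then at
  every point `z = (t, x)` with `T - ρ² < t ≤ T` (TOP INCLUDED), `x ∈ B_ρ(x₀)`, there are `r₁ > 0`
  and a function `W` CONTINUOUS ON THE CLOSURE of the backward cylinder `Q_{r₁}(z)` with `u = W`
  a.e. on `Q_{r₁}(z)`. Proof: as in the companion (viscous cylinder inside `Q_ρ(T, x₀)`, rescaling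
  to the unit cylinder with viscosity `1`, `ess_local_holder_holds`), then
  `W = (ν/R) · w ∘ Φ⁻¹` with `Φ` the space–time affine map of the rescaling
  (`stAffineHomeomorph`): `Φ⁻¹` maps `Q_{r₁}(z) ⊆ Q_ν(z, R/2)` into `Q_{1/2}(0, 0)`, hence its closure
  into the closure, where `w` is continuous; the a.e. identity is transported by
  `ae_restrict_of_ae_restrict_preimage_stAffine`.

This is the input of the E–C row «the blow-up profile of an unforced Clay blow-up is continuous off
its singular slice» (`Summits/…/FluidComputer/ClayBlowupProfile.lean`, seat ns-blowup-ecbridge-2 g8).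

## Tree search

All tools as in `ESSLocalHolderTopCylinder.lean`; plus `stAffineHomeomorph`, `stAffine_apply_symm`,
`stAffineHomeomorph_symm_apply_stAffine` (`SpaceTimeRescaling`), Mathlib `Set.MapsTo.closure`,
`ContinuousOn.comp`, `Homeomorph.continuous`.

## References

* L. Escauriaza, G. Seregin, V. Šverák, Russ. Math. Surveys 58 (2003) 211–250: Thm. 1.4, §3
  (scaling (3.5)–(3.7)). [EscauriazaSereginSverak2003]
-/

noncomputable section

open MeasureTheory Set Function Filter Topology TopologicalSpace Metric
open scoped NNReal ENNReal InnerProductSpace RealInnerProductSpace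

namespace Literature.Analysis.FluidPDE

/-- Viscous cylinders of positive radius are connected. [folklore] -/
private theorem isConnected_viscousCylinder'' {ν R : ℝ} (hν : 0 < ν) (hR : 0 < R)
    (z : ℝ × EuclideanSpace ℝ (Fin 3)) : IsConnected (viscousCylinder ν R z) := by
  refine ⟨⟨(z.1 - R ^ 2 / ν / 2, z.2), ?_⟩, ?_⟩
  · rw [mem_viscousCylinder, dist_self]
    have : 0 < R ^ 2 / ν := by positivity
    exact ⟨⟨by linarith, by linarith⟩, hR⟩
  · rw [viscousCylinder]
    exact ((convex_Ioo _ _).prod (convex_ball _ _)).isPreconnected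

/-- **Escauriaza–Seregin–Šverák's local theorem at the top of a backward cylinder, every viscosity and
size — continuous representative** (ESS 2003, Thm. 1.4 with the scaling of §3). Let `ν > 0`, `ρ > 0`,
and let `(Q_ρ(T, x₀), 0, u, p, G)` lie in Lemarié-Rieusset's §14.3 class with zero force (any force
exponent `q`), and suppose `u ∈ L^∞(T - ρ², T; L³(B_ρ(x₀)))`. Then for every `z = (t, x)` with
`T - ρ² < t ≤ T` and `x ∈ B_ρ(x₀)` there are `r₁ > 0` and `W : ℝ × ℝ³ → ℝ³`, continuous on the
CLOSURE of `Q_{r₁}(z)` (top slice `{t} × B̄(x, r₁)` included), with `u = W` a.e. on `Q_{r₁}(z)`.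
[cite: EscauriazaSereginSverak2003, Thm. 1.4 and §3 (3.5)–(3.7)] -/
theorem ess_continuousOn_near_top_of_L3 {ν ρ T q : ℝ} {x₀ : EuclideanSpace ℝ (Fin 3)}
    (hν : 0 < ν)
    {u : ℝ → EuclideanSpace ℝ (Fin 3) → EuclideanSpace ℝ (Fin 3)}
    {p : ℝ → EuclideanSpace ℝ (Fin 3) → ℝ}
    {G : ℝ → EuclideanSpace ℝ (Fin 3) → EuclideanSpace ℝ (Fin 3) →L[ℝ] EuclideanSpace ℝ (Fin 3)}
    (hS : IsLRSuitableWeakSolutionOn (parabolicCylinderOpens ρ (T, x₀)) ν q 0 u p G)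
    (hL3 : ∃ C : ℝ≥0, ∀ᵐ t ∂(volume.restrict (Ioo (T - ρ ^ 2) T)),
      ∫⁻ x in ball x₀ ρ, ‖u t x‖ₑ ^ 3 ≤ C) :
    ∀ z : ℝ × EuclideanSpace ℝ (Fin 3), z.1 ∈ Ioc (T - ρ ^ 2) T → z.2 ∈ ball x₀ ρ →
      ∃ r₁ : ℝ, 0 < r₁ ∧ ∃ W : ℝ × EuclideanSpace ℝ (Fin 3) → EuclideanSpace ℝ (Fin 3),
        ContinuousOn W (closure (parabolicCylinder r₁ z)) ∧
          uncurry u =ᵐ[volume.restrict (parabolicCylinder r₁ z)] W := by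
  intro z hzt hzx
  obtain ⟨t, x⟩ := z
  dsimp only at hzt hzx ⊢
  obtain ⟨C₃, hC₃⟩ := hL3
  have hC₃' : ∀ᵐ s : ℝ, s ∈ Ioo (T - ρ ^ 2) T → ∫⁻ y in ball x₀ ρ, ‖u s y‖ₑ ^ 3 ≤ C₃ :=
    (ae_restrict_iff' measurableSet_Ioo).1 hC₃
  -- the inflation factor `m' = max 1 ν`
  set m' : ℝ := max 1 ν with hm'
  have hm'1 : 1 ≤ m' := le_max_left _ _
  have hm'0 : 0 < m' := one_pos.trans_le hm'1
  have hm'ν : ν ≤ m' ^ 2 := le_sq_of_le_of_one_le (le_max_right _ _) hm'1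
  -- ## a viscous cylinder `Q_ν((t, x), R)` inside `Q_ρ(T, x₀)`
  have hgt : 0 < t - (T - ρ ^ 2) := sub_pos.2 hzt.1
  have hgx : 0 < ρ - dist x x₀ := sub_pos.2 (mem_ball.1 hzx)
  obtain ⟨R, hR, hRt, hRx⟩ : ∃ R : ℝ, 0 < R ∧ R ^ 2 / ν < t - (T - ρ ^ 2) ∧ R < ρ - dist x x₀ := by
    refine ⟨min ((ρ - dist x x₀) / 2) (min 1 (ν * (t - (T - ρ ^ 2)) / 2)), by positivity, ?_, ?_⟩
    · set R := min ((ρ - dist x x₀) / 2) (min 1 (ν * (t - (T - ρ ^ 2)) / 2)) with hRdef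
      have hR0 : 0 ≤ R := by positivity
      have hR1 : R ≤ 1 := (min_le_right _ _).trans (min_le_left _ _)
      have hR2 : R ≤ ν * (t - (T - ρ ^ 2)) / 2 := (min_le_right _ _).trans (min_le_right _ _)
      rw [div_lt_iff₀ hν]
      calc R ^ 2 = R * R := sq R
        _ ≤ 1 * (ν * (t - (T - ρ ^ 2)) / 2) := mul_le_mul hR1 hR2 hR0 zero_le_one
        _ < (t - (T - ρ ^ 2)) * ν := by nlinarith [mul_pos hν hgt]
    · exact (min_le_left _ _).trans_lt (by linarith)
  have hVQ : viscousCylinder ν R (t, x) ⊆ parabolicCylinder ρ (T, x₀) := by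
    intro w hw
    rw [mem_viscousCylinder] at hw
    rw [mem_parabolicCylinder]
    obtain ⟨⟨h1, h2⟩, h3⟩ := hw
    dsimp only at h1 h2 h3 ⊢
    refine ⟨⟨by linarith, by linarith [hzt.2]⟩, ?_⟩
    calc dist w.2 x₀ ≤ dist w.2 x + dist x x₀ := dist_triangle _ _ _
      _ < ρ := by linarith
  have hVQ' : viscousCylinderOpens ν R (t, x) ≤ parabolicCylinderOpens ρ (T, x₀) := hVQ
  have hSV : IsLRSuitableWeakSolutionOn (viscousCylinderOpens ν R (t, x)) ν q 0 u p G :=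
    hS.of_le_of_isConnected hVQ' (isConnected_viscousCylinder'' hν hR _)
  -- the `L³` bound on the slices of the viscous cylinder
  have hC₃V : ∀ᵐ s ∂(volume.restrict (Ioo (t + R ^ 2 / ν * (-1)) (t + R ^ 2 / ν * 0))),
      ∫⁻ y in ball x R, ‖u s y‖ₑ ^ 3 ≤ C₃ := by
    have hI : Ioo (t + R ^ 2 / ν * (-1)) (t + R ^ 2 / ν * 0) = Ioo (t - R ^ 2 / ν) t := by
      congr 1 <;> ring
    rw [hI, ae_restrict_iff' measurableSet_Ioo]
    filter_upwards [hC₃'] with s hs hsI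
    have hsI' : s ∈ Ioo (T - ρ ^ 2) T := ⟨by linarith [hsI.1], by linarith [hsI.2, hzt.2]⟩
    exact (lintegral_mono_set (ball_subset_ball' (by linarith))).trans (hs hsI')
  -- ## the rescaled datum on the unit cylinder, viscosity `1`, force `0`
  have hα : 0 < R / ν := by positivity
  have hβ : 0 < R ^ 2 / ν := by positivity
  have hβ' : R ^ 2 / ν = R / ν * R := by ring
  set z₀ : ℝ × EuclideanSpace ℝ (Fin 3) := ((0 : ℝ), (0 : EuclideanSpace ℝ (Fin 3))) with hz₀
  set u₁ : ℝ → EuclideanSpace ℝ (Fin 3) → EuclideanSpace ℝ (Fin 3) :=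
    (R / ν) • stPull (R ^ 2 / ν) R t x u with hu₁
  set p₁ : ℝ → EuclideanSpace ℝ (Fin 3) → ℝ := (R / ν) ^ 2 • stPull (R ^ 2 / ν) R t x p with hp₁
  set G₁ : ℝ → EuclideanSpace ℝ (Fin 3) → EuclideanSpace ℝ (Fin 3) →L[ℝ] EuclideanSpace ℝ (Fin 3) :=
    (R / ν * R) • stPull (R ^ 2 / ν) R t x G with hG₁
  have h1 : IsLRSuitableWeakSolutionOn (parabolicCylinderOpens 1 z₀) 1 q 0 u₁ p₁ G₁ := by
    have h := hSV.stRescale hα hR hβ' t x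
    have e1 : R / ν * ν / R = 1 := by field_simp
    have e2 : ((R / ν) ^ 2 * R) • stPull (R ^ 2 / ν) R t x
        (0 : ℝ → EuclideanSpace ℝ (Fin 3) → EuclideanSpace ℝ (Fin 3)) = 0 := by
      funext s y; simp [stPull]
    rw [e1, e2, stPreimage_viscousCylinderOpens_self hν hR, viscousCylinderOpens_one_one_zero] at h
    exact h
  have hQ₁ : parabolicCylinder 1 z₀ = Ioo (-1 : ℝ) 0 ×ˢ ball (0 : EuclideanSpace ℝ (Fin 3)) 1 := by
    rw [hz₀, parabolicCylinder]
    norm_num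
  -- (b) the energy class in sliced form
  have henergy : ∃ C : ℝ≥0, ∀ᵐ s ∂(volume.restrict (Ioo (-1 : ℝ) 0)),
      ∫⁻ y in ball (0 : EuclideanSpace ℝ (Fin 3)) 1, ‖u₁ s y‖ₑ ^ 2 ≤ C := by
    obtain ⟨CE, hCE⟩ := h1.energyClass
    refine ⟨CE, (ae_restrict_iff' measurableSet_Ioo).2 ?_⟩
    refine ae_setLIntegral_slice_le_of_energy hCE measurableSet_ball ?_
    rw [← hQ₁]
    exact Subset.rfl
  -- (e) the `L³` class in sliced form
  have hL3' : ∃ C : ℝ≥0, ∀ᵐ s ∂(volume.restrict (Ioo (-1 : ℝ) 0)),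
      ∫⁻ y in ball (0 : EuclideanSpace ℝ (Fin 3)) 1, ‖u₁ s y‖ₑ ^ 3 ≤ C := by
    have h := ae_sliced_setLIntegral_ball_stRescale hβ hR t x x R (-1) 0
      (fun s y => ‖u s y‖ₑ ^ 3) hC₃V
    have hball : ball (R⁻¹ • (x - x)) (R / R) = ball (0 : EuclideanSpace ℝ (Fin 3)) 1 := by
      rw [sub_self, smul_zero, div_self hR.ne']
    rw [hball] at h
    obtain ⟨C', hC'⟩ := exists_nnreal_of_ae_le
      (K := ‖R / ν‖ₑ ^ 3 * (ENNReal.ofReal (R ^ Module.finrank ℝ (EuclideanSpace ℝ (Fin 3)))⁻¹ * C₃))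
      (ENNReal.mul_ne_top (by simp) (ENNReal.mul_ne_top ENNReal.ofReal_ne_top ENNReal.coe_ne_top))
      (μ := volume.restrict (Ioo (-1 : ℝ) 0))
      (f := fun s => ∫⁻ y in ball (0 : EuclideanSpace ℝ (Fin 3)) 1, ‖u₁ s y‖ₑ ^ 3)
      (by
        filter_upwards [h] with s hs
        have e : ∀ y : EuclideanSpace ℝ (Fin 3), ‖u₁ s y‖ₑ ^ 3 =
            ‖R / ν‖ₑ ^ 3 * ‖u (t + R ^ 2 / ν * s) (x + R • y)‖ₑ ^ 3 := by
          intro y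
          rw [hu₁, smul_stPull_apply, enorm_smul, mul_pow]
        simp_rw [e]
        rw [lintegral_const_mul' _ _ (by simp)]
        exact mul_le_mul_right hs _)
    exact ⟨C', hC'⟩
  -- ## ESS Thm. 1.4 on the unit cylinder: a representative Hölder on the closure of `Q_{1/2}(0,0)`
  have hdist : IsDistributionalNSSolutionOn (parabolicCylinderOpens 1 z₀) 1 0 u₁ p₁ := h1.distributional
  obtain ⟨w, Cw, α, hα0, hHolder, hae⟩ := ess_local_holder_holds u₁ p₁ hdist henergy
    ⟨G₁, h1.weakGradient, h1.gradient_lt_top⟩ h1.pressure_lt_top hL3'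
  have hwc : ContinuousOn w (closure (parabolicCylinder (1 / 2) z₀)) := hHolder.continuousOn hα0
  -- ## transport back through the affine homeomorphism `Φ(s, y) = (t + (R²/ν) s, x + R y)`
  set Ψ := (stAffineHomeomorph hβ.ne' hR.ne' t x).symm with hΨ
  set W : ℝ × EuclideanSpace ℝ (Fin 3) → EuclideanSpace ℝ (Fin 3) :=
    fun z' => (R / ν)⁻¹ • w (Ψ z') with hW
  have hpre : parabolicCylinder (1 / 2) z₀ =
      stAffine (R ^ 2 / ν) R t x ⁻¹' viscousCylinder ν (R * (1 / 2)) (t, x) := by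
    rw [hz₀, stAffine_preimage_viscousCylinder hν hR, mul_div_cancel_left₀ _ hR.ne']
  -- `Ψ` maps the viscous cylinder `Q_ν((t,x), R/2)` into `Q_{1/2}(0,0)`
  have hmaps : MapsTo Ψ (viscousCylinder ν (R * (1 / 2)) (t, x)) (parabolicCylinder (1 / 2) z₀) := by
    intro z' hz'
    rw [hpre, mem_preimage, hΨ, stAffine_apply_symm]
    exact hz'
  have hsub : parabolicCylinder (R * (1 / 2) / m') (t, x) ⊆ viscousCylinder ν (R * (1 / 2)) (t, x) :=
    parabolicCylinder_subset_viscousCylinder hν hm'1 hm'ν (by positivity) _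
  refine ⟨R * (1 / 2) / m', by positivity, W, ?_, ?_⟩
  · -- continuity on the closure
    have hmaps' : MapsTo Ψ (closure (parabolicCylinder (R * (1 / 2) / m') (t, x)))
        (closure (parabolicCylinder (1 / 2) z₀)) :=
      (hmaps.mono_left hsub).closure Ψ.continuous
    have hcomp : ContinuousOn (fun z' => w (Ψ z'))
        (closure (parabolicCylinder (R * (1 / 2) / m') (t, x))) :=
      hwc.comp Ψ.continuous.continuousOn hmaps'
    exact hcomp.const_smul ((R / ν)⁻¹ : ℝ)
  · -- the a.e. identity `u = W` on `Q_ν((t,x), R/2) ⊇ Q_{R/(2m')}(t,x)`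
    have hbd' : ∀ᵐ z ∂(volume.restrict (parabolicCylinder (1 / 2) z₀)),
        uncurry u (stAffine (R ^ 2 / ν) R t x z) = W (stAffine (R ^ 2 / ν) R t x z) := by
      filter_upwards [hae] with z hz
      have hz' : (R / ν) • u (t + R ^ 2 / ν * z.1) (x + R • z.2) = w z := by
        have := hz
        simp only [uncurry, hu₁, smul_stPull_apply] at this
        exact this
      have e1 : stAffine (R ^ 2 / ν) R t x z = (t + R ^ 2 / ν * z.1, x + R • z.2) := rfl
      rw [hW]
      simp only
      rw [hΨ, stAffineHomeomorph_symm_apply_stAffine, ← hz', smul_smul,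
        inv_mul_cancel₀ hα.ne', one_smul, e1]
      rfl
    rw [hpre] at hbd'
    have h8 := ae_restrict_of_ae_restrict_preimage_stAffine hβ hR t x
      (P := fun z' => uncurry u z' = W z') hbd'
    exact ae_restrict_of_ae_restrict_of_subset hsub h8

end Literature.Analysis.FluidPDE

end
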